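/-
Copyright (c) 2026. All rights reserved.
Released under Apache 2.0 license as described in the file LICENSE.
-/
import Summits.HubbardSuperconductivity.HubbardLadder.Bounds.SectorTwistRatioElementary
import HarnessLib

/-!
# Theorem 13_N in a certified explicit window (bounds.tex §13, D5(e): the instance)

HONEST FRAMING: ladder R1–R4 with certified numbers; no claim on H/H₀. These are bounds for
MODEL CLASSES (the typed REPULSIVE `t–t'` Hubbard torus with a flux twist), no materials claim.

#211.24 `norm_ttSectorZ_twist_sub_le_elementary` bounds `‖Z_N(θ) - Z_N(0)‖` for the
fixed-`N` sector partition functions `Z_N(θ) = ttSectorZ L β t' U θ N` of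
`hubbardTorusTT'Flux L t' U θ` by a closed elementary expression, under a list of NUMERIC
hypotheses (arc floor, one-site Kotecký–Preiss smallness, off-arc fixed point, radii, window
arithmetic). This part DISCHARGES
every numeric hypothesis at the FIXED constants
`c₀ = 0, u₀ = 1/500, R = 201/100, a = 1/20, δ = 19/20, F = 129/100, r = 7/10, r₁ = 3/4,
K_w = 10L + 2` in the WINDOW
`0 < β, 0 ≤ U, β(1 + |t'|) ≤ 10⁻⁴, βU ≤ 1/500, 3L² ≤ 5N ≤ 7L² (|1 - N/L²| ≤ 2/5), L ≥ 101`,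
using only elementary Mathlib bounds (`e < 2.7182818286`, `eˣ ≤ 1/(1-x)`, `1 + x ≤ eˣ`,
`1 + x + x²/2 ≤ eˣ`, the Taylor bound `e^{1/4} ≤ 1.2848`, `π > 3`, `cos ≥ 0` on `[-π/2, π/2]`),
and majorises the three factors of the bound uniformly in the window:
`(4/3)(4√((1+4a/r²)L²) + 1) ≤ 8L`; walk exponent `≤ (48/125)L + 1606` (from `βr♯ ≤ 3/1250`,
`N - K_w + 1 ≥ L²/2`, `2L² - N - K_w + 1 ≥ L²/2`); tail `(e^{x} - 1) + 2e^{-ηL²} ≤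
(1/5)L²e^{-(19/20)L} + 2e^{-L²/40}` (`x = L²e^{-(19/20)L}/10 ≤ 1`, `κ₋ ≥ 22/125`, `η ≥ 1/40`).
RESULT (`norm_ttSectorZ_twist_sub_le_window`):
`‖Z_N(θ) - Z_N(0)‖ ≤ twistWindowMajorant L · Re Z_N(0)`,
`twistWindowMajorant L = 8L · e^{(48/125)L + 1606} · ((1/5)L² e^{-(19/20)L} + 2e^{-L²/40})`,
which tends to `0` (successor part: the node `HighTemperatureTwistInsensitivityTT'CanonicalN`).
The constants were reproduced by TWO independent implementations before typing
(`code/d5_constants_A.py`, stdlib fractions = the enclosures used below; `code/d5_constants_B.py`,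
60-digit decimal evaluation of the original hypotheses; both `CERT ALL: PASS`).
HONEST SIZE (stated, not hidden): `ln twistWindowMajorant(L) ≈ 1563` at `L = 101` and first `< 0`
at `L = 2881` — the walk factor `e^{0.384L + 1606}` (the `K_w ≈ 10L` bookkeeping of #211.17) against
the numerator `0.1L²e^{-0.95L}`: astronomically conservative; NO finite-`L` instance row is
claimed. The window (`T ≥ 10⁴(|t|+|t'|)`, `T ≥ 500U`, densities `N/L² ∈ [3/5, 7/5]`) is SMALLER than
the paper's `I_c4` (`β(|t|+|t'|) ≤ 1/1250`, `β|U| ≤ 1/50`); REPULSIVE class only. Zero kit, no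
`native_decide`, standard axioms only.
References: R. Kotecký, D. Preiss, Comm. Math. Phys. 103 (1986) 491 [KoteckyPreiss1986];
D. Ueltschi, Analyticity in Hubbard models, J. Stat. Phys. 95 (1999) 693, §2.3 Prop. 2.2
[Ueltschi1999]; bounds.tex §13.
-/

noncomputable section

namespace Summit.HubbardSuperconductivity.HubbardLadder.Bounds

open Matrix Finset Complex
open Literature.MathematicalPhysics.QuantumLattice
open scoped ComplexOrder

/-! ### Certified numeric hypotheses of Theorem 13_N at the window constants -/

/-- Arc floor `hfloor` at `c₀ = 0`, `u₀ = 1/500`, `R = 201/100`: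
`1 ≤ R²(1 - 1/2 - 1/(1 + e^{-u₀/2})²)`, via `1 - u₀/2 ≤ e^{-u₀/2}` (value `≈ 1.009`).
[programme: bounds.tex §13 D5(e); this file] -/
theorem ttWindow_hfloor :
    1 ≤ (201 / 100 : ℝ) ^ 2 *
      (1 - (1 - 0) / 2 - (1 - 0 ^ 2) / (1 + Real.exp (-((1 / 500 : ℝ) / 2))) ^ 2) := by
  have h1 : 1999 / 1000 ≤ 1 + Real.exp (-((1 / 500 : ℝ) / 2)) := by
    have := Real.add_one_le_exp (-((1 / 500 : ℝ) / 2)); linarith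
  have h2 : (1999 / 1000 : ℝ) ^ 2 ≤ (1 + Real.exp (-((1 / 500 : ℝ) / 2))) ^ 2 :=
    pow_le_pow_left₀ (by norm_num) h1 2
  have h3 : (1 - 0 ^ 2 : ℝ) / (1 + Real.exp (-((1 / 500 : ℝ) / 2))) ^ 2 ≤
      1 / (1999 / 1000) ^ 2 := by
    rw [show (1 - 0 ^ 2 : ℝ) = 1 by norm_num]
    exact one_div_le_one_div_of_le (by norm_num) h2
  have h4 : (1 : ℝ) / (1999 / 1000) ^ 2 ≤ 2503 / 10000 := by norm_num
  nlinarith [h3, h4]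

/-- The common Kotecký–Preiss factor `16 S e^{2S}`, `S = β(1 + |t'|) ≤ 10⁻⁴`:
`16 S e^{2S} ≤ 16 · 10⁻⁴ · (10000/9998)` (`e^{x} ≤ 1/(1 - x)`).
[cite: KoteckyPreiss1986, Thm p.492] [programme: bounds.tex §13 D5(e); this file] -/
theorem ttWindow_sixteen_mul_le {β t' : ℝ} (hβ : 0 < β) (hS : β * (1 + |t'|) ≤ 1 / 10000) :
    16 * (|β| * (1 + |t'|)) * Real.exp (2 * (|β| * (1 + |t'|))) ≤
      16 * (1 / 10000) * (10000 / 9998) := by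
  rw [abs_of_pos hβ]
  have h0 : 0 ≤ β * (1 + |t'|) := by positivity
  have hE : Real.exp (2 * (β * (1 + |t'|))) ≤ 10000 / 9998 :=
    calc Real.exp (2 * (β * (1 + |t'|))) ≤ Real.exp (2 / 10000) := Real.exp_le_exp.2 (by linarith)
      _ ≤ 1 / (1 - 2 / 10000) :=
          Real.exp_bound_div_one_sub_of_interval (by norm_num) (by norm_num)
      _ = 10000 / 9998 := by norm_num
  have h1 : β * (1 + |t'|) * Real.exp (2 * (β * (1 + |t'|))) ≤ 1 / 10000 * (10000 / 9998) :=
    mul_le_mul hS hE (Real.exp_pos _).le (by norm_num)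
  nlinarith [h1]

/-- One-site Kotecký–Preiss smallness `hsmall` in the window (`R = 201/100`, `a + δ = 1`,
`e ≤ 2.718281829`): `16 S e^{2S} (R e + a)² ≤ 0.04866 ≤ a = 1/20`.
[cite: KoteckyPreiss1986, Thm p.492] [programme: bounds.tex §13 D5(e); this file] -/
theorem ttWindow_hsmall {β t' : ℝ} (hβ : 0 < β) (hS : β * (1 + |t'|) ≤ 1 / 10000) :
    16 * (|β| * (1 + |t'|)) * Real.exp (2 * (|β| * (1 + |t'|))) *
      ((201 / 100 : ℝ) * Real.exp (1 / 20 + 19 / 20) + 1 / 20) ^ 2 ≤ 1 / 20 := by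
  have h1 := ttWindow_sixteen_mul_le hβ hS
  have he : Real.exp (1 / 20 + 19 / 20 : ℝ) ≤ 2718281829 / 1000000000 := by
    rw [show (1 / 20 + 19 / 20 : ℝ) = 1 by norm_num]
    exact (Real.exp_one_lt_d9.trans_le (by norm_num)).le
  have h2 : ((201 / 100 : ℝ) * Real.exp (1 / 20 + 19 / 20) + 1 / 20) ^ 2 ≤
      ((201 / 100 : ℝ) * (2718281829 / 1000000000) + 1 / 20) ^ 2 :=
    pow_le_pow_left₀ (by positivity) (by linarith) 2
  have h3 : ((201 / 100 : ℝ) * (2718281829 / 1000000000) + 1 / 20) ^ 2 ≤ 30402 / 1000 := by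
    norm_num
  calc _ ≤ 16 * (1 / 10000) * (10000 / 9998) * (30402 / 1000 : ℝ) :=
        mul_le_mul h1 (h2.trans h3) (by positivity) (by positivity)
    _ ≤ 1 / 20 := by norm_num

/-- `e^{1/4} ≤ 1.2848` (Taylor with remainder: `Real.exp_bound'` at order `3` gives `≤ 370/288`).
[this file] -/
theorem ttWindow_exp_quarter_le : Real.exp (1 / 4 : ℝ) ≤ 12848 / 10000 := by
  have h := Real.exp_bound' (x := (1 / 4 : ℝ)) (by norm_num) (by norm_num) (n := 3) (by norm_num)
  norm_num [Finset.sum_range_succ, Nat.factorial] at h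
  linarith

/-- Off-arc fixed point `hF` in the window (`F = 129/100`): `offArcRateCeil 0 u₀ ≤ 1/4`, so
`e^{κ̄} + 16 S e^{2S} F² ≤ 1.2848 + 0.0027 ≤ F`.
[programme: bounds.tex §13 D5(e); this file] -/
theorem ttWindow_hF {β t' : ℝ} (hβ : 0 < β) (hS : β * (1 + |t'|) ≤ 1 / 10000) :
    Real.exp (offArcRateCeil 0 (1 / 500)) +
      16 * (|β| * (1 + |t'|)) * Real.exp (2 * (|β| * (1 + |t'|))) * (129 / 100 : ℝ) ^ 2 ≤
        129 / 100 := by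
  have hk : offArcRateCeil 0 (1 / 500) ≤ 1 / 4 := by
    unfold offArcRateCeil
    have h1 : (2 : ℝ) ≤ 1 + Real.exp (1 / 500) := by
      linarith [Real.add_one_le_exp (1 / 500 : ℝ)]
    have h2 : (2 : ℝ) ≤ 1 + Real.exp (1 / 500 / 2) := by
      linarith [Real.add_one_le_exp (1 / 500 / 2 : ℝ)]
    rw [div_le_iff₀ (by positivity)]
    nlinarith [h1, h2]
  have he : Real.exp (offArcRateCeil 0 (1 / 500)) ≤ 12848 / 10000 :=
    (Real.exp_le_exp.2 hk).trans ttWindow_exp_quarter_le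
  have h2 : 16 * (|β| * (1 + |t'|)) * Real.exp (2 * (|β| * (1 + |t'|))) * (129 / 100 : ℝ) ^ 2 ≤
      16 * (1 / 10000) * (10000 / 9998) * (129 / 100) ^ 2 :=
    mul_le_mul_of_nonneg_right (ttWindow_sixteen_mul_le hβ hS) (by positivity)
  have h3 : (12848 / 10000 : ℝ) + 16 * (1 / 10000) * (10000 / 9998) * (129 / 100) ^ 2 ≤
      129 / 100 := by norm_num
  linarith

/-- Window arithmetic: `√((1 + 4a/r²)L²) ≤ (5/4)L` at `a = 1/20`, `r = 7/10`
(`1 + 4a/r² = 1 + 20/98 ≤ 25/16`), whence `8√(…) + 2 ≤ 10L + 2 = K_w`. [this file] -/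
theorem ttWindow_sqrt_le (L : ℕ) :
    Real.sqrt ((1 + 4 * (1 / 20 : ℝ) / (7 / 10) ^ 2) * (L : ℝ) ^ 2) ≤ 5 / 4 * L := by
  have hq : (1 + 4 * (1 / 20 : ℝ) / (7 / 10) ^ 2) ≤ (5 / 4) ^ 2 := by norm_num
  calc Real.sqrt ((1 + 4 * (1 / 20 : ℝ) / (7 / 10) ^ 2) * (L : ℝ) ^ 2)
      ≤ Real.sqrt ((5 / 4 * (L : ℝ)) ^ 2) :=
        Real.sqrt_le_sqrt (by rw [mul_pow]; exact mul_le_mul_of_nonneg_right hq (sq_nonneg _))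
    _ = 5 / 4 * L := Real.sqrt_sq (by positivity)

/-! ### Uniform majorants of the three factors in the window -/

/-- The walk exponent in the window: for `L ≥ 101`, `3L² ≤ 5N ≤ 7L²`, `0 ≤ b ≤ (3/625)L²`
(`b = 2βL²r♯`, `βr♯ ≤ 3/1250`) and `K_w = 10L + 2`, both `N - K_w + 1` and `2L² - N - K_w + 1` are
`≥ L²/2`, so `2K_w(b + 2K_w - 1)(1/(N-K_w+1) + 1/(2L²-N-K_w+1)) ≤ 8(10L+2)((3/625)L² + 20L +
3)/L² ≤ (48/125)L + 1606`. [programme: bounds.tex §13 D5(e); this file] -/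
theorem ttWindow_walk_exponent_le {L N b : ℝ} (hL : 101 ≤ L) (hN₁ : 3 * L ^ 2 ≤ 5 * N)
    (hN₂ : 5 * N ≤ 7 * L ^ 2) (hb₀ : 0 ≤ b) (hb : b ≤ 3 / 625 * L ^ 2) :
    2 * (10 * L + 2) * ((b + (2 * (10 * L + 2) - 1)) *
      (1 / (N - (10 * L + 2) + 1) + 1 / (2 * L ^ 2 - N - (10 * L + 2) + 1))) ≤
        48 / 125 * L + 1606 := by
  have hL0 : 0 < L := by linarith
  have hL2 : 0 < L ^ 2 := by positivity
  have hLL : 101 * L ≤ L ^ 2 := by nlinarith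
  have hA : L ^ 2 / 2 ≤ N - (10 * L + 2) + 1 := by linarith
  have hB : L ^ 2 / 2 ≤ 2 * L ^ 2 - N - (10 * L + 2) + 1 := by linarith
  have hApos : 0 < N - (10 * L + 2) + 1 := by linarith
  have hBpos : 0 < 2 * L ^ 2 - N - (10 * L + 2) + 1 := by linarith
  have hA' : 1 / (N - (10 * L + 2) + 1) ≤ 2 / L ^ 2 :=
    (div_le_div_iff₀ hApos hL2).2 (by linarith)
  have hB' : 1 / (2 * L ^ 2 - N - (10 * L + 2) + 1) ≤ 2 / L ^ 2 :=
    (div_le_div_iff₀ hBpos hL2).2 (by linarith)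
  have hM0 : 0 ≤ b + (2 * (10 * L + 2) - 1) := by linarith
  have hM : b + (2 * (10 * L + 2) - 1) ≤ 3 / 625 * L ^ 2 + 20 * L + 3 := by linarith
  have hS0 : 0 ≤ 1 / (N - (10 * L + 2) + 1) + 1 / (2 * L ^ 2 - N - (10 * L + 2) + 1) :=
    add_nonneg (one_div_nonneg.2 hApos.le) (one_div_nonneg.2 hBpos.le)
  have hK0 : 0 ≤ 2 * (10 * L + 2) := by positivity
  have hsum : 1 / (N - (10 * L + 2) + 1) + 1 / (2 * L ^ 2 - N - (10 * L + 2) + 1) ≤ 4 / L ^ 2 := by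
    rw [show (4 : ℝ) / L ^ 2 = 2 / L ^ 2 + 2 / L ^ 2 by ring]
    exact add_le_add hA' hB'
  calc 2 * (10 * L + 2) * ((b + (2 * (10 * L + 2) - 1)) *
        (1 / (N - (10 * L + 2) + 1) + 1 / (2 * L ^ 2 - N - (10 * L + 2) + 1)))
      ≤ 2 * (10 * L + 2) * ((3 / 625 * L ^ 2 + 20 * L + 3) * (4 / L ^ 2)) := by
        apply mul_le_mul_of_nonneg_left _ hK0
        exact mul_le_mul hM hsum hS0 (by positivity)
    _ = 8 * (10 * L + 2) * (3 / 625 * L ^ 2 + 20 * L + 3) / L ^ 2 := by ring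
    _ ≤ 48 / 125 * L + 1606 := by
        rw [div_le_iff₀ hL2]
        nlinarith [mul_nonneg (sub_nonneg.2 hL) (sub_nonneg.2 hL),
          mul_nonneg (sub_nonneg.2 hL) hL0.le]

/-- The density window `3L² ≤ 5N ≤ 7L²` is `|1 - N/L²| ≤ 2/5`. [this file] -/
theorem ttWindow_density {L N : ℝ} (hL : 0 < L) (hN₁ : 3 * L ^ 2 ≤ 5 * N)
    (hN₂ : 5 * N ≤ 7 * L ^ 2) : |1 - N / L ^ 2| ≤ 2 / 5 := by
  have hL2 : 0 < L ^ 2 := by positivity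
  have h1 : N / L ^ 2 ≤ 7 / 5 := by rw [div_le_iff₀ hL2]; linarith
  have h2 : 3 / 5 ≤ N / L ^ 2 := by rw [le_div_iff₀ hL2]; linarith
  rw [abs_le]
  constructor <;> linarith

/-- In the density window the off-arc rate floor of #211.23 is `≥ 22/125`:
`κ₋ = (1 - (|1-ρ| + 1/7)²)/((1 + e^{u₀})(1 + e^{u₀/2})) ≥ (864/1225)/(1999/499) ≥ 0.176`
(`e^{x} ≤ 1/(1-x)`). [programme: bounds.tex §13 D5(e); this file] -/
theorem ttWindow_offArcRateFloor_ge {ρ : ℝ} (hρ : |1 - ρ| ≤ 2 / 5) :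
    22 / 125 ≤ offArcRateFloor 0 (1 / 500) ρ (2 * (1 / 20) / (7 / 10)) := by
  unfold offArcRateFloor
  have hsq : (|1 - ρ| + 2 * (1 / 20) / (7 / 10)) ^ 2 ≤ (19 / 35 : ℝ) ^ 2 :=
    pow_le_pow_left₀ (by positivity) (by norm_num at hρ ⊢; linarith) 2
  have he1 : Real.exp (1 / 500 : ℝ) ≤ 500 / 499 :=
    (Real.exp_bound_div_one_sub_of_interval (by norm_num) (by norm_num)).trans (by norm_num)
  have he2 : Real.exp (1 / 500 / 2 : ℝ) ≤ 1000 / 999 :=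
    (Real.exp_bound_div_one_sub_of_interval (by norm_num) (by norm_num)).trans (by norm_num)
  have hDpos : 0 < (1 + Real.exp (1 / 500 : ℝ)) * (1 + Real.exp (1 / 500 / 2)) := by positivity
  have hD : (1 + Real.exp (1 / 500 : ℝ)) * (1 + Real.exp (1 / 500 / 2)) ≤ 1999 / 499 :=
    calc _ ≤ (1 + 500 / 499 : ℝ) * (1 + 1000 / 999) :=
          mul_le_mul (by linarith) (by linarith) (by positivity) (by norm_num)
      _ = 1999 / 499 := by norm_num
  rw [le_div_iff₀ hDpos]
  have hnum : (864 / 1225 : ℝ) ≤ (1 - 0) * (1 - (|1 - ρ| + 2 * (1 / 20) / (7 / 10)) ^ 2) := by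
    norm_num at hsq ⊢; linarith
  calc 22 / 125 * ((1 + Real.exp (1 / 500 : ℝ)) * (1 + Real.exp (1 / 500 / 2)))
      ≤ 22 / 125 * (1999 / 499 : ℝ) := by gcongr
    _ ≤ 864 / 1225 := by norm_num
    _ ≤ _ := hnum

/-- The off-arc decay rate `η = e^{κ} + κ - F - a ≥ 1/40` once `κ ≥ 22/125` (`F = 129/100`,
`a = 1/20`; `1 + κ + κ²/2 ≤ e^{κ}`). [this file] -/
theorem ttWindow_eta_ge {κ : ℝ} (hκ : 22 / 125 ≤ κ) :
    1 / 40 ≤ Real.exp κ + κ - 129 / 100 - 1 / 20 := by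
  have h0 : 0 ≤ κ := le_trans (by norm_num) hκ
  have h := Real.quadratic_le_exp_of_nonneg h0
  nlinarith [mul_nonneg h0 (sub_nonneg.2 hκ)]

/-- The Kotecký–Preiss numerator variable `x = 2aL²e^{-δL} = L²e^{-(19/20)L}/10 ≤ 1`
(`e^{y} ≥ 1 + y + y²/2`). [this file] -/
theorem ttWindow_x_le_one {L : ℝ} (hL : 0 ≤ L) :
    2 * (1 / 20) * L ^ 2 * Real.exp (-(19 / 20 * L)) ≤ 1 := by
  have h := Real.quadratic_le_exp_of_nonneg (show 0 ≤ 19 / 20 * L by positivity)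
  have hpos := Real.exp_pos (19 / 20 * L)
  rw [Real.exp_neg, show 2 * (1 / 20) * L ^ 2 * (Real.exp (19 / 20 * L))⁻¹ =
    (1 / 10 * L ^ 2) / Real.exp (19 / 20 * L) by ring, div_le_one hpos]
  nlinarith [sq_nonneg L]

/-- The tail factor in the window (`L ≥ 101`, `3L² ≤ 5N ≤ 7L²`):
`(e^{x} - 1) + 2e^{-ηL²} ≤ (1/5)L²e^{-(19/20)L} + 2e^{-L²/40}` (`e^{x} - 1 ≤ 2x` on `0 ≤ x ≤ 1`;
`η ≥ 1/40`). [programme: bounds.tex §13 D5(e); this file] -/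
theorem ttWindow_tail_le {L : ℕ} (hL : 101 ≤ L) {N : ℕ} (hN₁ : 3 * L ^ 2 ≤ 5 * N)
    (hN₂ : 5 * N ≤ 7 * L ^ 2) :
    (Real.exp (2 * (1 / 20) * (L : ℝ) ^ 2 * Real.exp (-(19 / 20 * L))) - 1) +
      2 * Real.exp (-((Real.exp (offArcRateFloor 0 (1 / 500) (N / (L : ℝ) ^ 2)
          (2 * (1 / 20) / (7 / 10))) +
        offArcRateFloor 0 (1 / 500) (N / (L : ℝ) ^ 2) (2 * (1 / 20) / (7 / 10)) -
          129 / 100 - 1 / 20) * (L : ℝ) ^ 2)) ≤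
      1 / 5 * (L : ℝ) ^ 2 * Real.exp (-(19 / 20 * L)) + 2 * Real.exp (-(1 / 40 * (L : ℝ) ^ 2)) := by
  have hL0 : (0 : ℝ) ≤ L := Nat.cast_nonneg _
  set x := 2 * (1 / 20) * (L : ℝ) ^ 2 * Real.exp (-(19 / 20 * L)) with hx
  have hx0 : 0 ≤ x := by positivity
  have hx1 : x ≤ 1 := ttWindow_x_le_one hL0
  have h1 : Real.exp x - 1 ≤ 2 * x := by
    have h := Real.abs_exp_sub_one_le (x := x) (by rw [abs_of_nonneg hx0]; exact hx1)
    rw [abs_of_nonneg hx0] at h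
    exact (le_abs_self _).trans h
  set κ := offArcRateFloor 0 (1 / 500) (N / (L : ℝ) ^ 2) (2 * (1 / 20) / (7 / 10)) with hκ
  have hLr : (101 : ℝ) ≤ L := by exact_mod_cast hL
  have hN₁' : (3 : ℝ) * (L : ℝ) ^ 2 ≤ 5 * N := by exact_mod_cast hN₁
  have hN₂' : (5 : ℝ) * N ≤ 7 * (L : ℝ) ^ 2 := by exact_mod_cast hN₂
  have hη : 1 / 40 ≤ Real.exp κ + κ - 129 / 100 - 1 / 20 :=
    ttWindow_eta_ge (ttWindow_offArcRateFloor_ge (ttWindow_density (by linarith) hN₁' hN₂'))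
  have h2 : Real.exp (-((Real.exp κ + κ - 129 / 100 - 1 / 20) * (L : ℝ) ^ 2)) ≤
      Real.exp (-(1 / 40 * (L : ℝ) ^ 2)) :=
    Real.exp_le_exp.2 (neg_le_neg (mul_le_mul_of_nonneg_right hη (sq_nonneg _)))
  have h3 : 2 * x = 1 / 5 * (L : ℝ) ^ 2 * Real.exp (-(19 / 20 * L)) := by rw [hx]; ring
  linarith

/-! ### Theorem 13_N in the window -/

/-- **The window majorant** `G(L) = 8L · e^{(48/125)L + 1606} · ((1/5)L²e^{-(19/20)L} +
2e^{-L²/40})` of Theorem 13_N in the certified window (HONEST SIZE: `ln G(101) ≈ 1563`, first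
`G(L) < 1` at `L = 2881`; it tends to `0`). [programme: bounds.tex §13 D5(e); this file] -/
def twistWindowMajorant (L : ℕ) : ℝ :=
  8 * (L : ℝ) * Real.exp (48 / 125 * (L : ℝ) + 1606) *
    (1 / 5 * (L : ℝ) ^ 2 * Real.exp (-(19 / 20 * (L : ℝ))) + 2 * Real.exp (-(1 / 40 * (L : ℝ) ^ 2)))

/-- `0 ≤ G(L)`. [this file] -/
theorem twistWindowMajorant_nonneg (L : ℕ) : 0 ≤ twistWindowMajorant L := by
  unfold twistWindowMajorant; positivity

section Torus

variable {L : ℕ} [NeZero L]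

/-- **THEOREM 13_N IN THE CERTIFIED WINDOW (bounds.tex §13, D5(e)).** For the REPULSIVE `t–t'`
Hubbard torus `Λ_L`, `L ≥ 101`, in the window `0 < β`, `0 ≤ U`, `β(1 + |t'|) ≤ 10⁻⁴`,
`βU ≤ 1/500`, every particle number `N` with `3L² ≤ 5N ≤ 7L²` and EVERY seam twist `θ`:
`‖Z_N(θ) - Z_N(0)‖ ≤ twistWindowMajorant L · Re Z_N(0)` — ONE application of #211.24
`norm_ttSectorZ_twist_sub_le_elementary` at `c₀ = 0, u₀ = 1/500, R = 201/100, a = 1/20,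
δ = 19/20, F = 129/100, r = 7/10, r₁ = 3/4, K_w = 10L + 2`, every numeric hypothesis discharged
above. [programme: bounds.tex §13 Theorem 13_N, D5(e); this file] -/
theorem norm_ttSectorZ_twist_sub_le_window (hL : 101 ≤ L) {β : ℝ} (hβ : 0 < β) {U : ℝ}
    (hU : 0 ≤ U) (t' θ : ℝ) (hS : β * (1 + |t'|) ≤ 1 / 10000) (hu : β * U ≤ 1 / 500) {N : ℕ}
    (hN₁ : 3 * L ^ 2 ≤ 5 * N) (hN₂ : 5 * N ≤ 7 * L ^ 2) :
    ‖ttSectorZ L β t' U θ N - ttSectorZ L β t' U 0 N‖ ≤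
      twistWindowMajorant L * (ttSectorZ L β t' U 0 N).re := by
  -- cardinalities `|Λ_L| = L²`, `|Orb Λ_L| = 2L²`
  have hΛ : Fintype.card (FermionTorus 2 L) = L ^ 2 := by simp [FermionTorus, Fintype.card_lex]
  have hO : Fintype.card (Orb (FermionTorus 2 L)) = 2 * L ^ 2 := by
    rw [Fintype.card_lex, Fintype.card_prod, Fintype.card_fin, hΛ, mul_comm]
  -- window arithmetic
  have hLL : 101 * L ≤ L ^ 2 := by rw [sq]; exact Nat.mul_le_mul_right L hL
  have hKwN : 10 * L + 2 ≤ N := by omega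
  have hNKw : N + (10 * L + 2) ≤ Fintype.card (Orb (FermionTorus 2 L)) := by rw [hO]; omega
  have hcardR : (Fintype.card (FermionTorus 2 L) : ℝ) = (L : ℝ) ^ 2 := by
    rw [hΛ]; push_cast; ring
  have hKw : 8 * Real.sqrt ((1 + 4 * (1 / 20 : ℝ) / (7 / 10) ^ 2) *
      Fintype.card (FermionTorus 2 L)) + 2 ≤ ((10 * L + 2 : ℕ) : ℝ) := by
    rw [hcardR]
    have := ttWindow_sqrt_le L
    push_cast
    linarith
  have hv : |β * U| ≤ 1 / 500 := by rwa [abs_of_nonneg (mul_nonneg hβ.le hU)]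
  have h := norm_ttSectorZ_twist_sub_le_elementary (L := L) (by omega) hβ hU t' θ (N := N)
    (Kw := 10 * L + 2) (c₀ := 0) (u₀ := 1 / 500) (R := 201 / 100) (a := 1 / 20) (δ := 19 / 20)
    (F := 129 / 100) (r := 7 / 10) (r₁ := 3 / 4) le_rfl hv (by norm_num) ttWindow_hfloor
    (by norm_num) (by norm_num) (ttWindow_hsmall hβ hS) (ttWindow_hF hβ hS) (by norm_num)
    (by norm_num) (by linarith [Real.pi_gt_three])
    (Real.cos_nonneg_of_mem_Icc ⟨by linarith [Real.pi_gt_three], by linarith [Real.pi_gt_three]⟩)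
    hKw hKwN hNKw
  -- the three factors, uniformly in the window
  have hLr : (101 : ℝ) ≤ L := by exact_mod_cast hL
  have hP : 4 / 3 * (4 * Real.sqrt ((1 + 4 * (1 / 20 : ℝ) / (7 / 10) ^ 2) * (L : ℝ) ^ 2) + 1) ≤
      8 * (L : ℝ) := by
    have := ttWindow_sqrt_le L; linarith
  have hN₁' : (3 : ℝ) * (L : ℝ) ^ 2 ≤ 5 * N := by exact_mod_cast hN₁
  have hN₂' : (5 : ℝ) * N ≤ 7 * (L : ℝ) ^ 2 := by exact_mod_cast hN₂
  have hb0 : 0 ≤ β * (2 * (L : ℝ) ^ 2 * ttCommRateSharp t' U) := by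
    have := ttCommRateSharp_nonneg t' U; positivity
  have hb : β * (2 * (L : ℝ) ^ 2 * ttCommRateSharp t' U) ≤ 3 / 625 * (L : ℝ) ^ 2 := by
    unfold ttCommRateSharp
    rw [abs_of_nonneg hU]
    have h1 : β * (4 + 4 * |t'| + U) ≤ 3 / 1250 := by linarith
    have h2 := mul_le_mul_of_nonneg_left h1 (by positivity : (0 : ℝ) ≤ 2 * (L : ℝ) ^ 2)
    linarith
  have hre : 0 ≤ (ttSectorZ L β t' U 0 N).re := (ttSectorZ_pos β t' U 0 (by omega)).1.le
  unfold twistWindowMajorant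
  refine h.trans (mul_le_mul_of_nonneg_right ?_ hre)
  refine mul_le_mul (mul_le_mul hP (Real.exp_le_exp.2 ?_) (Real.exp_pos _).le (by positivity))
    (ttWindow_tail_le hL hN₁ hN₂)
    (add_nonneg (sub_nonneg.2 (Real.one_le_exp (by positivity))) (by positivity)) (by positivity)
  push_cast
  exact ttWindow_walk_exponent_le hLr hN₁' hN₂' hb0 hb

end Torus

end Summit.HubbardSuperconductivity.HubbardLadder.Bounds

end
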